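import Summits.ValiantsHypothesis.ValiantsHypothesis.Theorems.LangWeilTransferTameResolutionSizeCalculus

/-!
# LangWeilTransfer, support item `TameResolution` (stmt-ValiantsHypothesis-6378) — the nested
# weight of `p ∈ ℤ[T][X']` against the weight of its flattening

Route `LangWeilTransfer` of `ValiantsHypothesis` (conditional route; honest framing: bookkeeping,
nothing here bears on VP ≠ VNP). Quantitative pass (roadmap note of val-lit-p6 g9, §4 (NQ)→(S)):
`weight_coeff_universalEliminant_le` (`LangWeilTransferTameResolutionEliminantSizes`) takes the
NESTED weight `Σ_β wt(coeff_β S_k)` of the transported equations, while the Noether loop bounds the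
FLAT weight of `S'_k = Γ(S_k)`. Here: the monomial formula for `sumAlgEquiv` and the inequality
"nested weight ≤ flat weight" (the converse of `weight_sumAlgEquiv_symm_le`).

* `sum_weight_coeff_le_weight_flat` — `Σ_{β} wt(coeff_β p) ≤ wt((sumAlgEquiv)⁻¹ p)` (the monomial
  formula for `sumAlgEquiv` and the flat-side inequality are kept private: the same statements are
  public in val-width's `LangWeilTransferTameResolutionCoordinateBasis`, landed concurrently).
-/

noncomputable section

open MvPolynomial
open Literature.Computability.AlgebraicComplexity

-- the summit and the problem share the name `ValiantsHypothesis` (D-0017 single-conjunct layout)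
set_option linter.dupNamespace false

namespace Summit.ValiantsHypothesis.ValiantsHypothesis.Theorems.LangWeilTransfer

variable {S₁ S₂ : Type*}

/-- The splitting iso on monomials. -/
private theorem sumAlgEquiv_monomial_aux {R : Type*} [CommRing R] (m : S₁ ⊕ S₂ →₀ ℕ) (c : R) :
    sumAlgEquiv R S₁ S₂ (monomial m c) =
      monomial (Finsupp.sumFinsuppAddEquivProdFinsupp m).1 (monomial (Finsupp.sumFinsuppAddEquivProdFinsupp m).2 c) := by
  simp [sumAlgEquiv, MvPolynomial.monomial, AddMonoidAlgebra.curryAlgEquiv_single]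

/-- Nested weight ≤ flat weight, flat side. -/
private theorem sum_weight_coeff_sumAlgEquiv_le_aux (f : MvPolynomial (S₁ ⊕ S₂) ℤ) :
    ((sumAlgEquiv ℤ S₁ S₂ f).support.sum fun β => weight ((sumAlgEquiv ℤ S₁ S₂ f).coeff β)) ≤ weight f := by
  classical
  set e := (Finsupp.sumFinsuppAddEquivProdFinsupp : (S₁ ⊕ S₂ →₀ ℕ) ≃+ (S₁ →₀ ℕ) × (S₂ →₀ ℕ)) with he
  set g := sumAlgEquiv ℤ S₁ S₂ f with hg
  -- `g = Σ_{m ∈ supp f} monomial (e m).1 (monomial (e m).2 (coeff m f))`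
  have hsum : g = ∑ m ∈ f.support, monomial (e m).1 (monomial (e m).2 (f.coeff m)) := by
    rw [hg]
    conv_lhs => rw [f.as_sum]
    rw [map_sum]
    exact Finset.sum_congr rfl fun m _ => sumAlgEquiv_monomial_aux m (f.coeff m)
  -- coefficientwise bound
  have hcoeff : ∀ β, weight (g.coeff β) ≤ ∑ m ∈ f.support with (e m).1 = β, (f.coeff m).natAbs := by
    intro β
    rw [hsum, coeff_sum]
    simp only [coeff_monomial]
    rw [← Finset.sum_filter]
    refine (weight_finset_sum_le _ _).trans (Finset.sum_le_sum fun m hm => ?_)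
    rw [Finset.mem_filter] at hm
    rw [weight_monomial]
  -- sum over the fibres
  set t := g.support ∪ f.support.image (fun m => (e m).1) with ht
  calc (g.support.sum fun β => weight (g.coeff β))
      ≤ t.sum fun β => weight (g.coeff β) :=
        Finset.sum_le_sum_of_subset_of_nonneg Finset.subset_union_left (fun _ _ _ => Nat.zero_le _)
    _ ≤ t.sum fun β => ∑ m ∈ f.support with (e m).1 = β, (f.coeff m).natAbs :=
        Finset.sum_le_sum fun β _ => hcoeff β
    _ = ∑ m ∈ f.support, (f.coeff m).natAbs := by
        refine Finset.sum_fiberwise_of_maps_to (fun m hm => ?_) _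
        exact Finset.mem_union_right _ (Finset.mem_image_of_mem _ hm)
    _ = weight f := rfl

/-- **Nested weight ≤ flat weight**, for `p ∈ ℤ[X_{S₂}][X_{S₁}]` and its flattening. -/
theorem sum_weight_coeff_le_weight_flat (p : MvPolynomial S₁ (MvPolynomial S₂ ℤ)) :
    (p.support.sum fun β => weight (p.coeff β)) ≤ weight ((sumAlgEquiv ℤ S₁ S₂).symm p) := by
  have h := sum_weight_coeff_sumAlgEquiv_le_aux ((sumAlgEquiv ℤ S₁ S₂).symm p)
  rwa [AlgEquiv.apply_symm_apply] at h

end Summit.ValiantsHypothesis.ValiantsHypothesis.Theorems.LangWeilTransfer
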